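import Mathlib
import Summits.NavierStokesRegularity.NavierStokesRegularity.Theorems.FilamentSkeletonRssSkeletonJ1NormalBlockWindow
import Summits.NavierStokesRegularity.NavierStokesRegularity.Theorems.FilamentSkeletonRssSkeletonJ1NormalBlockCeiling

/-!
# Area-law slaving, part 3 — GROWTH of the slaved core area along the arms: `Aa ≲ 1 + (τ − c)²/Γ`
# (`FilamentSkeletonRss`, child crux `TangentSkeletonNearStraight`, stmt-NavierStokesRegularity-28295, line
# `child_tangent_analytic_strip`, ∃-side of the registered stub `stub_analyticClosing`, step (v): "the transported areas are
# slaved … `Aa ∼ C·s²` on the relaxed arms ⇒ cone bound")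

Under the AREA LAW `w·A′ = (3/2 − w′)·A + 4` (`A > 0`, `w(c) = 0`) the product `B = w·A` obeys `B′ = (3/2)·A + 4` exactly
(Theorems.SkeletonJ1NormalBlockWindow.areaLaw_hasDerivAt_mul).  Three comparison bricks turn lower barriers for the slip into
upper bounds for the area, all by `antitoneOn_of_deriv_nonpos` (no integration):

* §1 `areaLaw_reflect` — the law is invariant under `τ ↦ 2c − τ`, `(w, A) ↦ (−w(2c−·), A(2c−·))`, so right-sided bricks
  give two-sided theorems.
* §2 `areaLaw_exp_growth_right` — on `[s₀, s₁]` where `w ≥ wmin > 0`: `B′ ≤ (3/(2 wmin))·B + 4`, hence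
  `B(τ) + 8wmin/3 ≤ (B(s₀) + 8wmin/3)·e^{3(τ−s₀)/(2 wmin)}` (Grönwall by monotonicity of `(B + 4/K)e^{−Kτ}`).
* §3 `areaLaw_quadratic_growth_right` — beyond `s₁` where `w(τ) ≥ u(τ) := (τ−c)/2 − C₀ > 0` (the far-field slip of the
  similarity drift `½y`, up to a bounded defect): `Φ = B/u³ + 4/u²` is non-increasing (`Φ′ = (3/2)·A·(u − w)/u⁴ ≤ 0`), hence
  `A(τ) ≤ Φ(s₁)·u(τ)²` — QUADRATIC growth, the exponent `(3/2 − w′)/w′ = 2` of the far slope `w′ = 1/2`.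
* §4 `areaLaw_arm_bound` — assembly with the landed core-window ceiling `A ≤ 4/δ` on `|τ−c| ≤ S₀`
  (Theorems.SkeletonJ1NormalBlockCeiling.areaLaw_ceiling_window, uniform supercriticality `w′ ≥ 3/2 + δ` there) and the slip floor
  `m|τ−c| ≤ |w|` on the intermediate range: for EVERY `τ`,
  `A(τ) ≤ 4/δ + A_II + Q·(τ − c)²`, `A_II = (4Λ/δ + 8m/3)·e^{3(S₁−S₀)/(2mS₀)}/m`, `Q = (ΛS₁A_II/u₁³ + 4/u₁²)/4`, `u₁ = S₁/2 − C₀`.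
  With the waist scalings `S₀ = σ₀√Γ`, `S₁ = σ₁√Γ`, `C₀ = c₀√Γ` the coefficient `Q` is `Q₀/Γ` with `Q₀` Γ-free — which is what the
  Γ-flat cone clause `Rw²Γ·Aa ≤ KA·(Rw²Γ + ‖X‖²)` of `FlatJ1G` needs (part 4 does that bookkeeping with the escape clause).

HONEST FRAMING: elementary ODE comparison serving a HYPOTHETICAL filament skeleton on the NEGATIVE side of a MODEL route
(A1G aside); nothing here bears on Navier–Stokes regularity or blow-up, and no registered stub is closed by this file.
`--supports stmt-NavierStokesRegularity-28295`.
-/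

set_option linter.dupNamespace false

noncomputable section

namespace Summit.NavierStokesRegularity.NavierStokesRegularity.Theorems.AreaLawSlaving

open Set Real
open Summit.NavierStokesRegularity.NavierStokesRegularity.Theorems.SkeletonJ1NormalBlockWindow
open Summit.NavierStokesRegularity.NavierStokesRegularity.Theorems.SkeletonJ1NormalBlockCeiling

/-! ## §1 Reflection symmetry of the area law -/

/-- Derivative of the reflected slip: `(−w(2c−·))′(τ) = w′(2c − τ)`. [folklore] -/
theorem deriv_reflect_neg (w : ℝ → ℝ) (c τ : ℝ) : deriv (fun x => -w (2 * c - x)) τ = deriv w (2 * c - τ) := by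
  have : (fun x => -w (2 * c - x)) = -(fun y => w (2 * c - y)) := rfl
  rw [this, deriv.neg, deriv_comp_const_sub w (2 * c) τ, neg_neg]

/-- **Reflection.**  If `(w, A)` satisfy the area law then so do `(τ ↦ −w(2c − τ), τ ↦ A(2c − τ))`. [folklore] -/
theorem areaLaw_reflect {w A : ℝ → ℝ} {c : ℝ}
    (hlaw : ∀ τ, w τ * deriv A τ = (3 / 2 - deriv w τ) * A τ + 4) (τ : ℝ) :
    (fun x => -w (2 * c - x)) τ * deriv (fun x => A (2 * c - x)) τ =
      (3 / 2 - deriv (fun x => -w (2 * c - x)) τ) * (fun x => A (2 * c - x)) τ + 4 := by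
  simp only [deriv_comp_const_sub A (2 * c) τ, deriv_reflect_neg w c τ]
  linarith [hlaw (2 * c - τ)]

/-- The reflected slip is differentiable. [folklore] -/
theorem differentiable_reflect_neg {w : ℝ → ℝ} (hw : Differentiable ℝ w) (c : ℝ) :
    Differentiable ℝ fun x => -w (2 * c - x) := (hw.comp ((differentiable_const _).sub differentiable_id)).neg

/-- The reflected area is differentiable. [folklore] -/
theorem differentiable_reflect {A : ℝ → ℝ} (hA : Differentiable ℝ A) (c : ℝ) :
    Differentiable ℝ fun x => A (2 * c - x) := hA.comp ((differentiable_const _).sub differentiable_id)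

/-! ## §2 Exponential (Grönwall) growth on a range where the slip is bounded below -/

/-- **Exponential growth brick.**  Under the area law with `A > 0`, on an interval `[s₀, s₁]` where `w ≥ wmin > 0`:
`w(τ)A(τ) + 8wmin/3 ≤ (w(s₀)A(s₀) + 8wmin/3)·exp(3(τ − s₀)/(2wmin))` for `τ ∈ [s₀, s₁]`. [folklore] -/
theorem areaLaw_exp_growth_right {w A : ℝ → ℝ} (hw : Differentiable ℝ w) (hA : Differentiable ℝ A)
    (hlaw : ∀ τ, w τ * deriv A τ = (3 / 2 - deriv w τ) * A τ + 4) (hpos : ∀ τ, 0 < A τ)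
    {s₀ s₁ wmin : ℝ} (hwmin : 0 < wmin) (hws : ∀ τ ∈ Icc s₀ s₁, wmin ≤ w τ) {τ : ℝ} (hτ : τ ∈ Icc s₀ s₁) :
    w τ * A τ + 8 * wmin / 3 ≤ (w s₀ * A s₀ + 8 * wmin / 3) * Real.exp (3 / (2 * wmin) * (τ - s₀)) := by
  set K : ℝ := 3 / (2 * wmin) with hK
  have hKpos : 0 < K := by rw [hK]; positivity
  have hK4 : 4 / K = 8 * wmin / 3 := by rw [hK]; field_simp; ring
  -- Ψ(τ) = (B + 4/K) e^{-K τ} is antitone on [s₀, s₁]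
  have hΨd : ∀ x, HasDerivAt (fun x => (w x * A x + 4 / K) * Real.exp (-K * x))
      ((3 / 2 * A x + 4) * Real.exp (-K * x) + (w x * A x + 4 / K) * (Real.exp (-K * x) * (-K))) x := by
    intro x
    have hB := (areaLaw_hasDerivAt_mul hw hA hlaw x).add_const (4 / K)
    have hE : HasDerivAt (fun x => Real.exp (-K * x)) (Real.exp (-K * x) * (-K)) x := by
      have := ((hasDerivAt_id' x).const_mul (-K)).exp
      simpa using this
    exact hB.mul hE
  have hanti : AntitoneOn (fun x => (w x * A x + 4 / K) * Real.exp (-K * x)) (Icc s₀ s₁) := by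
    apply antitoneOn_of_deriv_nonpos (convex_Icc s₀ s₁)
    · exact HasDerivAt.continuousOn fun x _ => hΨd x
    · exact fun x _ => (hΨd x).differentiableAt.differentiableWithinAt
    · intro x hx
      rw [interior_Icc] at hx
      rw [(hΨd x).deriv]
      have hwx : wmin ≤ w x := hws x (Ioo_subset_Icc_self hx)
      have hAx := hpos x
      have hKB : 3 / 2 * A x ≤ K * (w x * A x) := by
        rw [hK]
        have : 3 / 2 * A x = 3 / (2 * wmin) * (wmin * A x) := by field_simp
        rw [this]
        exact mul_le_mul_of_nonneg_left (mul_le_mul_of_nonneg_right hwx hAx.le) (by positivity)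
      have hE : 0 < Real.exp (-K * x) := Real.exp_pos _
      have : (3 / 2 * A x + 4) * Real.exp (-K * x) + (w x * A x + 4 / K) * (Real.exp (-K * x) * -K) =
          Real.exp (-K * x) * (3 / 2 * A x - K * (w x * A x)) := by field_simp; ring
      rw [this]
      exact mul_nonpos_of_nonneg_of_nonpos hE.le (by linarith)
  have h := hanti (left_mem_Icc.2 (hτ.1.trans hτ.2)) hτ hτ.1
  simp only at h
  rw [hK4] at h
  have hE : 0 < Real.exp (-K * τ) := Real.exp_pos _
  have key : (w τ * A τ + 8 * wmin / 3) ≤ (w s₀ * A s₀ + 8 * wmin / 3) * (Real.exp (-K * s₀) / Real.exp (-K * τ)) := by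
    rw [← mul_div_assoc, le_div_iff₀ hE]; exact h
  have hexp : Real.exp (-K * s₀) / Real.exp (-K * τ) = Real.exp (K * (τ - s₀)) := by
    rw [← Real.exp_sub]; congr 1; ring
  rwa [hexp] at key

/-! ## §3 Quadratic growth beyond the range where the slip dominates half the similarity drift -/

/-- **Quadratic growth brick.**  Under the area law with `A > 0`: if beyond `s₁` the slip dominates the barrier
`u(τ) = (τ − c)/2 − C₀` (`u(s₁) > 0`, `u ≤ w` on `[s₁, ∞)`), then for `τ ≥ s₁`
`A(τ) ≤ (w(s₁)A(s₁)/u(s₁)³ + 4/u(s₁)²) · u(τ)²`. [folklore] -/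
theorem areaLaw_quadratic_growth_right {w A : ℝ → ℝ} (hw : Differentiable ℝ w) (hA : Differentiable ℝ A)
    (hlaw : ∀ τ, w τ * deriv A τ = (3 / 2 - deriv w τ) * A τ + 4) (hpos : ∀ τ, 0 < A τ)
    {s₁ c C₀ : ℝ} (hu₁ : 0 < (s₁ - c) / 2 - C₀) (hbar : ∀ τ, s₁ ≤ τ → (τ - c) / 2 - C₀ ≤ w τ)
    {τ : ℝ} (hτ : s₁ ≤ τ) :
    A τ ≤ (w s₁ * A s₁ / ((s₁ - c) / 2 - C₀) ^ 3 + 4 / ((s₁ - c) / 2 - C₀) ^ 2) * ((τ - c) / 2 - C₀) ^ 2 := by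
  -- the barrier and its positivity on [s₁, ∞)
  have hupos : ∀ x, s₁ ≤ x → 0 < (x - c) / 2 - C₀ := fun x hx => by linarith
  have hud : ∀ x, HasDerivAt (fun x => (x - c) / 2 - C₀) (1 / 2 : ℝ) x := by
    intro x
    have := (((hasDerivAt_id' x).sub_const c).div_const 2).sub_const C₀
    simpa using this
  -- Φ = B/u³ + 4/u²
  have hΦd : ∀ x, s₁ ≤ x → HasDerivAt (fun x => w x * A x / ((x - c) / 2 - C₀) ^ 3 + 4 / ((x - c) / 2 - C₀) ^ 2)
      (((3 / 2 * A x + 4) * ((x - c) / 2 - C₀) ^ 3 - w x * A x * (3 * ((x - c) / 2 - C₀) ^ 2 * (1 / 2))) /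
          (((x - c) / 2 - C₀) ^ 3) ^ 2 +
        -(4 * (2 * ((x - c) / 2 - C₀) ^ 1 * (1 / 2))) / (((x - c) / 2 - C₀) ^ 2) ^ 2) x := by
    intro x hx
    have hu := hupos x hx
    have hB := areaLaw_hasDerivAt_mul hw hA hlaw x
    have hu3 : HasDerivAt (fun x => ((x - c) / 2 - C₀) ^ 3) (3 * ((x - c) / 2 - C₀) ^ 2 * (1 / 2)) x := by
      have := (hud x).fun_pow 3
      exact this.congr_deriv (by norm_num)
    have hu2 : HasDerivAt (fun x => ((x - c) / 2 - C₀) ^ 2) (2 * ((x - c) / 2 - C₀) ^ 1 * (1 / 2)) x := by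
      have := (hud x).fun_pow 2
      exact this.congr_deriv (by norm_num)
    have h1 := hB.div hu3 (pow_ne_zero 3 hu.ne')
    have h2 := (hasDerivAt_const x (4:ℝ)).div hu2 (pow_ne_zero 2 hu.ne')
    have h2' : HasDerivAt (fun x => 4 / ((x - c) / 2 - C₀) ^ 2)
        (-(4 * (2 * ((x - c) / 2 - C₀) ^ 1 * (1 / 2))) / (((x - c) / 2 - C₀) ^ 2) ^ 2) x := by
      refine h2.congr_deriv ?_; ring
    exact h1.add h2'
  have hanti : AntitoneOn (fun x => w x * A x / ((x - c) / 2 - C₀) ^ 3 + 4 / ((x - c) / 2 - C₀) ^ 2) (Ici s₁) := by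
    apply antitoneOn_of_deriv_nonpos (convex_Ici s₁)
    · exact HasDerivAt.continuousOn fun x hx => hΦd x hx
    · intro x hx
      rw [interior_Ici] at hx
      exact (hΦd x (le_of_lt hx)).differentiableAt.differentiableWithinAt
    · intro x hx
      rw [interior_Ici] at hx
      have hx' : s₁ ≤ x := le_of_lt hx
      rw [(hΦd x hx').deriv]
      have hu := hupos x hx'
      set u : ℝ := (x - c) / 2 - C₀ with hudef
      have hwu : u ≤ w x := hbar x hx'
      have hAx := hpos x
      -- the derivative equals (3/2)·A·(u − w)/u⁴ ≤ 0
      have hsimp : ((3 / 2 * A x + 4) * u ^ 3 - w x * A x * (3 * u ^ 2 * (1 / 2))) / (u ^ 3) ^ 2 +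
          -(4 * (2 * u ^ 1 * (1 / 2))) / (u ^ 2) ^ 2 = 3 / 2 * A x * (u - w x) / u ^ 4 := by
        field_simp
        ring
      rw [hsimp]
      apply div_nonpos_of_nonpos_of_nonneg _ (by positivity)
      have : u - w x ≤ 0 := by linarith
      exact mul_nonpos_of_nonneg_of_nonpos (by positivity) this
  have h := hanti (self_mem_Ici (a := s₁)) (mem_Ici.2 hτ) hτ
  simp only at h
  -- h : Φ τ ≤ Φ s₁ ; extract A τ ≤ Φ(s₁) u(τ)²
  have hu := hupos τ hτ
  set u : ℝ := (τ - c) / 2 - C₀ with hudef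
  have hwu : u ≤ w τ := hbar τ hτ
  have hwpos : 0 < w τ := lt_of_lt_of_le hu hwu
  have hB : 0 < w τ * A τ := mul_pos hwpos (hpos τ)
  have h4 : 0 ≤ 4 / u ^ 2 := by positivity
  have hBu : w τ * A τ / u ^ 3 ≤ w s₁ * A s₁ / ((s₁ - c) / 2 - C₀) ^ 3 + 4 / ((s₁ - c) / 2 - C₀) ^ 2 := by
    linarith
  -- A τ ≤ (w τ A τ)/u = (B/u³)·u² ≤ Φ(s₁) u²
  have hA1 : A τ ≤ w τ * A τ / u := by
    rw [le_div_iff₀ hu, mul_comm (w τ)]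
    exact mul_le_mul_of_nonneg_left hwu (hpos τ).le
  have hA2 : w τ * A τ / u = (w τ * A τ / u ^ 3) * u ^ 2 := by
    field_simp
  calc A τ ≤ w τ * A τ / u := hA1
    _ = (w τ * A τ / u ^ 3) * u ^ 2 := hA2
    _ ≤ _ := mul_le_mul_of_nonneg_right hBu (sq_nonneg u)

/-! ## §4 Assembly: the arm bound `A ≤ 4/δ + A_II + Q·(τ − c)²` -/

/-- **Right-arm bound.**  Area law, `A > 0`, `w(c) = 0`; uniform supercriticality `w′ ≥ 3/2 + δ` on `|τ − c| ≤ S₀`; slope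
bound `|w′| ≤ Λ`; slip floor `m(τ − c) ≤ w(τ)` for `τ ≥ c`; far barrier `(τ−c)/2 − C₀ ≤ w(τ)` for `τ − c ≥ S₁`, with
`0 < S₀ ≤ S₁`, `0 ≤ C₀ < S₁/2`.  Then for every `τ ≥ c`:
`A(τ) ≤ 4/δ + A_II + Q·(τ−c)²` with `A_II = (4Λ/δ + 8m/3)·exp(3(S₁−S₀)/(2mS₀))/m` and
`Q = (ΛS₁A_II/(S₁/2−C₀)³ + 4/(S₁/2−C₀)²)/4`. [folklore] -/
theorem areaLaw_arm_bound_right {w A : ℝ → ℝ} (hw : Differentiable ℝ w) (hA : Differentiable ℝ A)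
    (hlaw : ∀ τ, w τ * deriv A τ = (3 / 2 - deriv w τ) * A τ + 4) (hpos : ∀ τ, 0 < A τ) {c : ℝ} (hc : w c = 0)
    {δ S₀ S₁ Λ m C₀ : ℝ} (hδ : 0 < δ) (hS₀ : 0 < S₀) (hS₁ : S₀ ≤ S₁) (hm : 0 < m) (hC₀ : 0 ≤ C₀)
    (hu₁ : 0 < S₁ / 2 - C₀)
    (hsup : ∀ s, |s - c| ≤ S₀ → 3 / 2 + δ ≤ deriv w s) (hΛ : ∀ τ, |deriv w τ| ≤ Λ)
    (hfloor : ∀ τ, c ≤ τ → m * (τ - c) ≤ w τ) (hfar : ∀ τ, S₁ ≤ τ - c → (τ - c) / 2 - C₀ ≤ w τ)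
    {τ : ℝ} (hτ : c ≤ τ) :
    A τ ≤ 4 / δ + (4 * Λ / δ + 8 * m / 3) * Real.exp (3 * (S₁ - S₀) / (2 * m * S₀)) / m +
      (Λ * S₁ * ((4 * Λ / δ + 8 * m / 3) * Real.exp (3 * (S₁ - S₀) / (2 * m * S₀)) / m) / (S₁ / 2 - C₀) ^ 3 +
        4 / (S₁ / 2 - C₀) ^ 2) / 4 * (τ - c) ^ 2 := by
  set AII : ℝ := (4 * Λ / δ + 8 * m / 3) * Real.exp (3 * (S₁ - S₀) / (2 * m * S₀)) / m with hAII
  have hΛ0 : 0 ≤ Λ := le_trans (abs_nonneg _) (hΛ c)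
  have hAII0 : 0 ≤ AII := by rw [hAII]; positivity
  have hS₁0 : 0 ≤ S₁ := hS₀.le.trans hS₁
  have hup3 : 0 < (S₁ / 2 - C₀) ^ 3 := pow_pos hu₁ 3
  have hup2 : 0 < (S₁ / 2 - C₀) ^ 2 := pow_pos hu₁ 2
  have hQ0 : 0 ≤ (Λ * S₁ * AII / (S₁ / 2 - C₀) ^ 3 + 4 / (S₁ / 2 - C₀) ^ 2) / 4 := by
    apply div_nonneg _ (by norm_num)
    exact add_nonneg (div_nonneg (by positivity) hup3.le) (div_nonneg (by norm_num) hup2.le)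
  -- region I: the core window
  have hI : ∀ x, |x - c| ≤ S₀ → A x ≤ 4 / δ := fun x hx => areaLaw_ceiling_window hw hA hlaw hpos hc hδ hsup hx
  -- slip size
  have hwle : ∀ x, c ≤ x → w x ≤ Λ * (x - c) := by
    intro x hx
    have h := slip_abs_le_of_deriv_bound hw hc hΛ x
    rw [abs_of_nonneg (sub_nonneg.2 hx)] at h
    exact (le_abs_self _).trans h
  -- region II: [c + S₀, c + S₁], w ≥ m S₀
  have hII : ∀ x ∈ Icc (c + S₀) (c + S₁), A x ≤ AII := by
    intro x hx
    have hwmin : 0 < m * S₀ := mul_pos hm hS₀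
    have hws : ∀ y ∈ Icc (c + S₀) (c + S₁), m * S₀ ≤ w y := by
      intro y hy
      have h1 := hfloor y (by linarith [hy.1])
      have h2 : m * S₀ ≤ m * (y - c) := mul_le_mul_of_nonneg_left (by linarith [hy.1]) hm.le
      exact h2.trans h1
    have hgrow := areaLaw_exp_growth_right hw hA hlaw hpos hwmin hws hx
    -- B(c+S₀) ≤ Λ S₀ · 4/δ
    have hB0 : w (c + S₀) * A (c + S₀) ≤ Λ * S₀ * (4 / δ) := by
      have h1 : w (c + S₀) ≤ Λ * S₀ := by have := hwle (c + S₀) (by linarith); simpa using this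
      have h2 : A (c + S₀) ≤ 4 / δ := hI (c + S₀) (by rw [show c + S₀ - c = S₀ by ring, abs_of_pos hS₀])
      have h3 : 0 ≤ w (c + S₀) := le_trans hwmin.le (hws (c + S₀) (left_mem_Icc.2 (by linarith)))
      exact mul_le_mul h1 h2 (hpos _).le (by positivity)
    have hexp : Real.exp (3 / (2 * (m * S₀)) * (x - (c + S₀))) ≤ Real.exp (3 * (S₁ - S₀) / (2 * m * S₀)) := by
      apply Real.exp_le_exp.2
      rw [show 3 * (S₁ - S₀) / (2 * m * S₀) = 3 / (2 * (m * S₀)) * (S₁ - S₀) by ring]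
      exact mul_le_mul_of_nonneg_left (by linarith [hx.2]) (by positivity)
    have hBx : w x * A x ≤ (Λ * S₀ * (4 / δ) + 8 * (m * S₀) / 3) * Real.exp (3 * (S₁ - S₀) / (2 * m * S₀)) := by
      have h1 : w x * A x + 8 * (m * S₀) / 3 ≤
          (w (c + S₀) * A (c + S₀) + 8 * (m * S₀) / 3) * Real.exp (3 / (2 * (m * S₀)) * (x - (c + S₀))) := hgrow
      have h2 : (w (c + S₀) * A (c + S₀) + 8 * (m * S₀) / 3) * Real.exp (3 / (2 * (m * S₀)) * (x - (c + S₀))) ≤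
          (Λ * S₀ * (4 / δ) + 8 * (m * S₀) / 3) * Real.exp (3 * (S₁ - S₀) / (2 * m * S₀)) :=
        mul_le_mul (by linarith) hexp (Real.exp_pos _).le (by positivity)
      have h3 : 0 ≤ 8 * (m * S₀) / 3 := by positivity
      linarith
    -- A x = B x / w x ≤ B x /(m S₀)
    have hwx : m * S₀ ≤ w x := hws x hx
    have hwxpos : 0 < w x := lt_of_lt_of_le hwmin hwx
    have hAx : A x ≤ w x * A x / (m * S₀) := by
      rw [le_div_iff₀ hwmin]
      calc A x * (m * S₀) ≤ A x * w x := mul_le_mul_of_nonneg_left hwx (hpos x).le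
        _ = w x * A x := mul_comm _ _
    have hfin : w x * A x / (m * S₀) ≤ AII := by
      rw [div_le_iff₀ hwmin, hAII]
      have : (4 * Λ / δ + 8 * m / 3) * Real.exp (3 * (S₁ - S₀) / (2 * m * S₀)) / m * (m * S₀) =
          (Λ * S₀ * (4 / δ) + 8 * (m * S₀) / 3) * Real.exp (3 * (S₁ - S₀) / (2 * m * S₀)) := by
        rw [div_mul_eq_mul_div, div_eq_iff hm.ne']
        ring
      rw [this]; exact hBx
    exact hAx.trans hfin
  -- region III: τ - c ≥ S₁
  have hIII : ∀ x, S₁ ≤ x - c → A x ≤ (Λ * S₁ * AII / (S₁ / 2 - C₀) ^ 3 + 4 / (S₁ / 2 - C₀) ^ 2) / 4 * (x - c) ^ 2 := by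
    intro x hx
    have hu₁' : 0 < (c + S₁ - c) / 2 - C₀ := by rw [show c + S₁ - c = S₁ by ring]; exact hu₁
    have hbar : ∀ y, c + S₁ ≤ y → (y - c) / 2 - C₀ ≤ w y := fun y hy => hfar y (by linarith)
    have hq := areaLaw_quadratic_growth_right hw hA hlaw hpos hu₁' hbar (show c + S₁ ≤ x by linarith)
    rw [show c + S₁ - c = S₁ by ring] at hq
    -- B(c + S₁) ≤ Λ S₁ · AII
    have hB1 : w (c + S₁) * A (c + S₁) ≤ Λ * S₁ * AII := by
      have h1 : w (c + S₁) ≤ Λ * S₁ := by have := hwle (c + S₁) (by linarith); simpa using this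
      have h2 : A (c + S₁) ≤ AII := hII (c + S₁) ⟨by linarith, le_rfl⟩
      have h3 : 0 ≤ w (c + S₁) := by
        have := hfloor (c + S₁) (by linarith)
        have h4 : 0 ≤ m * (c + S₁ - c) := by rw [show c + S₁ - c = S₁ by ring]; positivity
        linarith
      exact mul_le_mul h1 h2 (hpos _).le (by positivity)
    have hcoef : w (c + S₁) * A (c + S₁) / (S₁ / 2 - C₀) ^ 3 + 4 / (S₁ / 2 - C₀) ^ 2 ≤
        Λ * S₁ * AII / (S₁ / 2 - C₀) ^ 3 + 4 / (S₁ / 2 - C₀) ^ 2 := by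
      have : w (c + S₁) * A (c + S₁) / (S₁ / 2 - C₀) ^ 3 ≤ Λ * S₁ * AII / (S₁ / 2 - C₀) ^ 3 :=
        div_le_div_of_nonneg_right hB1 hup3.le
      linarith
    have husq : ((x - c) / 2 - C₀) ^ 2 ≤ (x - c) ^ 2 / 4 := by
      have h1 : 0 ≤ (x - c) / 2 - C₀ := by linarith
      have h2 : (x - c) / 2 - C₀ ≤ (x - c) / 2 := by linarith
      calc ((x - c) / 2 - C₀) ^ 2 ≤ ((x - c) / 2) ^ 2 := pow_le_pow_left₀ h1 h2 2
        _ = (x - c) ^ 2 / 4 := by ring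
    have hc0 : 0 ≤ w (c + S₁) * A (c + S₁) / (S₁ / 2 - C₀) ^ 3 + 4 / (S₁ / 2 - C₀) ^ 2 := by
      have h3 : 0 ≤ w (c + S₁) := by
        have := hfloor (c + S₁) (by linarith)
        have h4 : 0 ≤ m * (c + S₁ - c) := by rw [show c + S₁ - c = S₁ by ring]; positivity
        linarith
      have : 0 ≤ w (c + S₁) * A (c + S₁) := mul_nonneg h3 (hpos _).le
      exact add_nonneg (div_nonneg this hup3.le) (div_nonneg (by norm_num) hup2.le)
    calc A x ≤ (w (c + S₁) * A (c + S₁) / (S₁ / 2 - C₀) ^ 3 + 4 / (S₁ / 2 - C₀) ^ 2) * ((x - c) / 2 - C₀) ^ 2 := hq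
      _ ≤ (Λ * S₁ * AII / (S₁ / 2 - C₀) ^ 3 + 4 / (S₁ / 2 - C₀) ^ 2) * ((x - c) ^ 2 / 4) :=
          mul_le_mul hcoef husq (sq_nonneg _) (hc0.trans hcoef)
      _ = (Λ * S₁ * AII / (S₁ / 2 - C₀) ^ 3 + 4 / (S₁ / 2 - C₀) ^ 2) / 4 * (x - c) ^ 2 := by ring
  -- assembly over the three regions
  have hsq : 0 ≤ (Λ * S₁ * AII / (S₁ / 2 - C₀) ^ 3 + 4 / (S₁ / 2 - C₀) ^ 2) / 4 * (τ - c) ^ 2 :=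
    mul_nonneg hQ0 (sq_nonneg _)
  have hδ4 : 0 ≤ 4 / δ := by positivity
  by_cases h1 : τ - c ≤ S₀
  · have := hI τ (by rw [abs_of_nonneg (sub_nonneg.2 hτ)]; exact h1)
    linarith
  · push Not at h1
    by_cases h2 : τ - c ≤ S₁
    · have := hII τ ⟨by linarith, by linarith⟩
      linarith
    · push Not at h2
      have := hIII τ h2.le
      linarith

/-- **Two-sided arm bound.**  As `areaLaw_arm_bound_right`, with the two-sided hypotheses
`m|τ − c| ≤ |w τ|` and `|τ − c|/2 − C₀ ≤ |w τ|` for `|τ − c| ≥ S₁`: for EVERY `τ`,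
`A(τ) ≤ 4/δ + A_II + Q·(τ − c)²` (reflection `τ ↦ 2c − τ` for the left arm). [folklore] -/
theorem areaLaw_arm_bound {w A : ℝ → ℝ} (hw : Differentiable ℝ w) (hA : Differentiable ℝ A)
    (hlaw : ∀ τ, w τ * deriv A τ = (3 / 2 - deriv w τ) * A τ + 4) (hpos : ∀ τ, 0 < A τ) {c : ℝ} (hc : w c = 0)
    {δ S₀ S₁ Λ m C₀ : ℝ} (hδ : 0 < δ) (hS₀ : 0 < S₀) (hS₁ : S₀ ≤ S₁) (hm : 0 < m) (hC₀ : 0 ≤ C₀)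
    (hu₁ : 0 < S₁ / 2 - C₀)
    (hsup : ∀ s, |s - c| ≤ S₀ → 3 / 2 + δ ≤ deriv w s) (hΛ : ∀ τ, |deriv w τ| ≤ Λ)
    (hfloor : ∀ τ, m * |τ - c| ≤ |w τ|) (hfar : ∀ τ, S₁ ≤ |τ - c| → |τ - c| / 2 - C₀ ≤ |w τ|) (τ : ℝ) :
    A τ ≤ 4 / δ + (4 * Λ / δ + 8 * m / 3) * Real.exp (3 * (S₁ - S₀) / (2 * m * S₀)) / m +
      (Λ * S₁ * ((4 * Λ / δ + 8 * m / 3) * Real.exp (3 * (S₁ - S₀) / (2 * m * S₀)) / m) / (S₁ / 2 - C₀) ^ 3 +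
        4 / (S₁ / 2 - C₀) ^ 2) / 4 * (τ - c) ^ 2 := by
  -- signs of the slip from the area law
  have hwpos : ∀ x, c < x → 0 < w x := fun x hx => areaLaw_pos_of_lt hw hA hlaw hpos hc hx
  have hwneg : ∀ x, x < c → w x < 0 := fun x hx => areaLaw_neg_of_lt hw hA hlaw hpos hc hx
  rcases le_total c τ with hτ | hτ
  · -- right arm
    refine areaLaw_arm_bound_right hw hA hlaw hpos hc hδ hS₀ hS₁ hm hC₀ hu₁ hsup hΛ ?_ ?_ hτ
    · intro x hx
      rcases hx.eq_or_lt with h | h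
      · rw [← h, hc, sub_self, mul_zero]
      · have h1 := hfloor x
        rw [abs_of_pos (sub_pos.2 h), abs_of_pos (hwpos x h)] at h1
        exact h1
    · intro x hx
      have hxc : c < x := by linarith [hS₀.trans_le hS₁]
      have h1 := hfar x (by rw [abs_of_pos (sub_pos.2 hxc)]; exact hx)
      rw [abs_of_pos (sub_pos.2 hxc), abs_of_pos (hwpos x hxc)] at h1
      exact h1
  · -- left arm, by reflection
    have hw' := differentiable_reflect_neg hw c
    have hA' := differentiable_reflect hA c
    have hlaw' := areaLaw_reflect (c := c) hlaw
    have hpos' : ∀ x, 0 < (fun x => A (2 * c - x)) x := fun x => hpos _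
    have hc' : (fun x => -w (2 * c - x)) c = 0 := by
      show -w (2 * c - c) = 0
      rw [show 2 * c - c = c by ring, hc, neg_zero]
    have hsup' : ∀ s, |s - c| ≤ S₀ → 3 / 2 + δ ≤ deriv (fun x => -w (2 * c - x)) s := by
      intro s hs
      rw [deriv_reflect_neg]
      exact hsup _ (by rw [show 2 * c - s - c = -(s - c) by ring, abs_neg]; exact hs)
    have hΛ' : ∀ x, |deriv (fun x => -w (2 * c - x)) x| ≤ Λ := fun x => by rw [deriv_reflect_neg]; exact hΛ _
    have hfloor' : ∀ x, c ≤ x → m * (x - c) ≤ (fun x => -w (2 * c - x)) x := by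
      intro x hx
      rcases hx.eq_or_lt with h | h
      · rw [← h]
        show m * (c - c) ≤ -w (2 * c - c)
        rw [sub_self, mul_zero, show 2 * c - c = c by ring, hc, neg_zero]
      · have h1 := hfloor (2 * c - x)
        have hlt : 2 * c - x < c := by linarith
        rw [show 2 * c - x - c = -(x - c) by ring, abs_neg, abs_of_pos (sub_pos.2 h),
          abs_of_neg (hwneg _ hlt)] at h1
        exact h1
    have hfar' : ∀ x, S₁ ≤ x - c → (x - c) / 2 - C₀ ≤ (fun x => -w (2 * c - x)) x := by
      intro x hx
      have hxc : c < x := by linarith [hS₀.trans_le hS₁]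
      have hlt : 2 * c - x < c := by linarith
      have hx2 : S₁ ≤ |2 * c - x - c| := by
        rw [show 2 * c - x - c = -(x - c) by ring, abs_neg, abs_of_pos (sub_pos.2 hxc)]; exact hx
      have h1 := hfar (2 * c - x) hx2
      rw [show 2 * c - x - c = -(x - c) by ring, abs_neg, abs_of_pos (sub_pos.2 hxc),
        abs_of_neg (hwneg _ hlt)] at h1
      exact h1
    have h := areaLaw_arm_bound_right hw' hA' hlaw' hpos' hc' hδ hS₀ hS₁ hm hC₀ hu₁ hsup' hΛ' hfloor' hfar'
      (show c ≤ 2 * c - τ by linarith)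
    simp only [show 2 * c - (2 * c - τ) = τ by ring] at h
    rw [show (2 * c - τ - c) ^ 2 = (τ - c) ^ 2 by ring] at h
    exact h

end Summit.NavierStokesRegularity.NavierStokesRegularity.Theorems.AreaLawSlaving

end
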